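import Literature.Probability.RandomPlanarGeometry.StarHullExtension
import Literature.Probability.RandomPlanarGeometry.RestrictionZeroOne
import Literature.Probability.Process.GaussianTaylorStep
import Mathlib.Analysis.SpecialFunctions.Sqrt
import Mathlib.Analysis.Calculus.Deriv.Shift
import HarnessLib

/-!
# The analytic half of [LSW] Prop. 4.1 (Virág): `Im Φ_A / Im` is harmonic for the excursion in `ℝ × ℝ³`, with the right boundary values

Proof-only file (no named fact; four auxiliary notions with real definitions), after

* G. F. Lawler, O. Schramm, W. Werner, *Conformal restriction: the chordal case*, J. Amer.
  Math. Soc. **16** (2003) 917–955, arXiv:math/0209343 (**[LSW]**, arXiv page numbers), §4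
  "Brownian excursions" (p. 16): "Let `X` be a standard one-dimensional Brownian motion and `Y`
  an independent three-dimensional Bessel process […] a three-dimensional Bessel process is the
  modulus (Euclidean norm) of a three-dimensional Brownian motion […] Note that almost surely
  `lim_{t→∞} Y_t = ∞`. The Brownian excursion can be defined as `B_t = X_t + iY_t`. […] `B` is a
  strong Markov process and `B(0, ∞) ⊂ ℍ` almost surely"; **Prop. 4.1** ("due to Bálint Virág"):
  "For all `A ∈ 𝒬*`, `P[B[0, ∞) ∩ A = ∅] = Φ_A'(0)`", with, in its proof, the two displays
  "`P[Z ⊂ ℍ ∖ A] = Im[Φ(z)]/Im(z)`" (for the excursion `Z` started at `z ∈ ℍ ∖ A`) and "When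
  `z → 0`, `Φ(z) = zΦ'(0) + O(|z|²)` so that
  `P[B[0, ∞) ∩ A = ∅] = lim_{s→0} P[B[s, ∞) ⊂ ℍ ∖ A] = lim_{s→0} E[Im(Φ(B_s))/Im(B_s)] = Φ'(0)`
  (one can use dominated convergence here, since `Im(Φ(z)) ≤ Im(z)` for all `z`)";
* B. Virág, *Brownian beads*, Probab. Theory Related Fields 127 (2003) 367–387 (the excursion
  restriction formula);
* D. Revuz, M. Yor, *Continuous Martingales and Brownian Motion* (1999), Ch. VI §3 (the
  three-dimensional Bessel process as `|W⃗|` for a three-dimensional Brownian motion `W⃗`, and as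
  Doob's `h`-transform, `h(y) = y`, of Brownian motion killed at `0`).

STATE OF THE TREE (2026-08-15). Every remaining leaf of the chordal-restriction cone — p. 5
result 2 (`LawlerSchrammWerner2003`, `IsRestrictionMeasure.eq_five_eighths_of_simple`,
`…_of_outer_simple`), Cor. 8.6, the "only if" half of p. 5 result 1 — is reduced to the
existence of SOME two-sided restriction measure of exponent `1`
(`IsRestrictionMeasure.eq_five_eighths_of_simple_of_exists_one`, `LawlerSchrammWerner2003_of_exists_one`,
file `OneSidedExcursionCloudInterior`), and that in turn (`exists_isRestrictionMeasure_of_chordalPath`,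
file `ChordalPathFill`) to a random path which is almost surely a chordal path avoiding each
`A ∈ 𝒬*` with probability `Φ'_A(0)` — in [LSW], the Brownian excursion of Prop. 4.1. [LSW]
derive the first display of the proof from the conformal invariance of planar Brownian motion
("`Φ ∘ W` is a time-changed Brownian motion"). The tree's route to the same display is Doob's
`h`-transform in the form available to it: with the Bessel process realized as the modulus
`|W⃗|` of `W⃗ = (W¹, W², W³)`, independent of `X = W⁰` — so that the excursion is the image
`Z = W⁰ + i|W⃗|` of a FOUR-dimensional Brownian motion `W` (`Process.IsBrownianVec`, Dynkin's
martingale `f(W_t) − ½∫₀ᵗ Δf(W_r) dr` and the stopped identity `E[V(x₀ + W_{t∧T})] = V(x₀)` for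
`V ∈ C²` with `ΔV = 0`, files `Process/BrownianVec`, `Process/BrownianVecHarmonic`) — the
conditional probability `Im Φ(z)/Im z` becomes the function

  `U(p) = Im Φ_A(p₀ + i |(p₁, p₂, p₃)|) / |(p₁, p₂, p₃)|`   on   `D_A = {|(p₁,p₂,p₃)| ≠ 0, p₀ + i|(p₁,p₂,p₃)| ∉ A} ⊆ ℝ⁴`

(`excursionRatio Φ`, `exDom A`), and what the stopping argument needs about it is proved HERE:

* `contDiffOn_excursionRatio`, `lap_excursionRatio_eq_zero` — **`U` is smooth and HARMONIC on
  `D_A`** for the Laplacian `Process.lap` of `Process/GaussianTaylorStep` (the one in Dynkin's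
  formula): if `u` is harmonic in the plane and vanishes on the axis, then `u(x, |w|)/|w|` is
  harmonic in `ℝ × ℝ³` off `{w = 0}`; here `u = Im Φ_A`, and the second derivatives along the
  four coordinate lines are computed explicitly from `Φ_A'`, `Φ_A''`
  (`ExcursionHarmonic.hess_apply_eq_of_hasDerivAt` identifies `D²f(p)(v, v)` with
  `(t ↦ f(p + tv))''(0)`; `ExcursionHarmonic.hess_excursionRatio_zero`, `…_of_ne`);
* `excursionRatio_pos`, `excursionRatio_le_one` — **`0 < U ≤ 1`** on `D_A` ("`Im(Φ(z)) ≤ Im(z)`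
  for all `z`", the domination in the proof; `IsRestrictionMap.im_le_im`, [LSW] §2 p. 7);
* `IsRestrictionMap.tendsto_im_div_im_nhdsWithin_zero` — **`Im Φ_A(z)/Im z → Φ'_A(0)` as
  `z → 0` in `ℍ ∖ A`** (the last display of the proof, "`Φ(z) = zΦ'(0) + O(|z|²)`", made
  uniform in the direction of approach: strict differentiability at `0` of the Schwarz
  reflection `hullExt Φ` of `StarHullExtension`, applied to the pair `(z, z̄)`), and its form on
  `ℝ⁴` (`tendsto_excursionRatio_nhdsWithin_zero`);
* `IsRestrictionMap.exists_forall_im_sub_im_le` — **`Im z − Im Φ_A(z) ≤ C`** on `ℍ ∖ A`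
  (`hullExt Φ z − z → L ∈ ℝ` at `∞`, `tendsto_hullExt_sub_self`; cf. "when `Im(z) → ∞`,
  `Im(Φ⁻¹(z)) = Im(z) + o(1)`" in the proof), whence `1 − C/|w| ≤ U`
  (`one_sub_div_le_excursionRatio`) and `U → 1` along the excursion, given "`lim Y_t = ∞`";
* `IsRestrictionMap.tendsto_im_nhdsWithin_of_mem` — **`Im Φ_A(z) → 0` as `z → a ∈ A` inside
  `ℍ ∖ A`** (the excursion hitting `A`: `Φ_A` is a homeomorphism onto `ℍ`, bounded near `a`,
  `IsRestrictionMap.isBounded_image`), and its form on `ℝ⁴` (`tendsto_excursionRatio_of_mem`);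
* `measurable_indicator_excursionRatio` — a Borel measurable version (`U` on `D_A`, `0`
  elsewhere), and `excursionRatio_spec` bundling everything for the probabilistic half.

The probabilistic half (the four-dimensional Brownian motion, "`B(0, ∞) ⊂ ℍ`" and
"`lim Y_t = ∞`" for `|W⃗|`, the optional stopping and the two limits) is not touched here. No new
named fact is introduced.

## References

* [LSW] G. F. Lawler, O. Schramm, W. Werner, *Conformal restriction: the chordal case*, J. Amer.
  Math. Soc. 16 (2003), §4 (arXiv p. 16): the excursion, Prop. 4.1 and its proof; §2 p. 7
  (`Im g_A(z) ≤ Im z`), p. 12 (Schwarz reflection). [LawlerSchrammWerner2003Restriction]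
* B. Virág, *Brownian beads*, Probab. Theory Related Fields 127 (2003) 367–387. [Virag2003]
* D. Revuz, M. Yor, *Continuous Martingales and Brownian Motion* (1999), Ch. VI §3. [RevuzYor1999]
-/


noncomputable section

open Set Filter Metric Bornology Function Asymptotics
open _root_.Complex _root_.Topology
open UpperHalfPlane (upperHalfPlaneSet isOpen_upperHalfPlaneSet)
open Literature.Probability.Process (bvec hess lap)
open scoped ComplexConjugate

namespace Literature.Probability.RandomPlanarGeometry

namespace ExcursionHarmonic

/-! ### Second derivatives along lines: `D²f(p)(v, v) = (t ↦ f(p + t v))''(0)` -/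

section Bridge

variable {d : ℕ} {f : (Fin d → ℝ) → ℝ} {p v : Fin d → ℝ}

/-- **The diagonal of the Hessian along a line.** If `f` is `C²` at `p`, `t ↦ f(p + t v)` has
derivative `g₁(t)` for `t` near `0` and `g₁` has derivative `c` at `0`, then
`D²f(p)(v, v) = c`. [folklore] -/
theorem hess_apply_eq_of_hasDerivAt (hf : ContDiffAt ℝ 2 f p) {g₁ : ℝ → ℝ} {c : ℝ}
    (h₁ : ∀ᶠ t in 𝓝 (0 : ℝ), HasDerivAt (fun s : ℝ ↦ f (p + s • v)) (g₁ t) t)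
    (h₂ : HasDerivAt g₁ c 0) : hess f p v v = c := by
  -- the path `γ(t) = p + t v`
  have hγ : ∀ t : ℝ, HasDerivAt (fun s : ℝ ↦ p + s • v) v t := fun t ↦ by
    simpa using ((hasDerivAt_id t).smul_const v).const_add p
  -- `f` is differentiable near `p`, `fderiv f` is differentiable at `p`
  have hfd : ∀ᶠ y in 𝓝 p, DifferentiableAt ℝ f y :=
    (hf.eventually (by simp)).mono fun y hy ↦ hy.differentiableAt (by simp)
  have hLd : DifferentiableAt ℝ (fderiv ℝ f) p :=
    (hf.fderiv_right (m := 1) (by norm_num)).differentiableAt one_ne_zero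
  -- (a) `g₁ t = fderiv f (γ t) v` near `0`
  have hγ0 : Tendsto (fun s : ℝ ↦ p + s • v) (𝓝 0) (𝓝 p) := by
    simpa using (hγ 0).continuousAt.tendsto
  have heq : g₁ =ᶠ[𝓝 0] fun t ↦ fderiv ℝ f (p + t • v) v := by
    filter_upwards [h₁, hγ0.eventually hfd] with t ht hdt
    have h' : HasDerivAt (fun s : ℝ ↦ f (p + s • v)) (fderiv ℝ f (p + t • v) v) t :=
      hdt.hasFDerivAt.comp_hasDerivAt t (hγ t)
    exact ht.unique h'
  -- (b) `t ↦ fderiv f (γ t) v` has derivative `D²f(p)(v,v)` at `0`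
  have hL : HasDerivAt (fun t : ℝ ↦ fderiv ℝ f (p + t • v)) (fderiv ℝ (fderiv ℝ f) p v) 0 :=
    hLd.hasFDerivAt.comp_hasDerivAt_of_eq (0 : ℝ) (hγ 0) (by simp)
  have hLv : HasDerivAt (fun t : ℝ ↦ fderiv ℝ f (p + t • v) v) (fderiv ℝ (fderiv ℝ f) p v v) 0 :=
    (ContinuousLinearMap.apply ℝ ℝ v).hasFDerivAt.comp_hasDerivAt (0 : ℝ) hL
  -- (c) compare
  exact (hLv.unique (h₂.congr_of_eventuallyEq heq.symm)).symm ▸ rfl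

end Bridge

end ExcursionHarmonic

/-! ### The excursion coordinates on `ℝ⁴ = ℝ × ℝ³` -/

section Coordinates

/-- **`|w|` for `p = (x, w) ∈ ℝ × ℝ³`**: the modulus of the last three coordinates (the
three-dimensional Bessel process of the excursion, evaluated along a four-dimensional Brownian
path). [cite: LawlerSchrammWerner2003Restriction, §4 p. 16 (Y a three-dimensional Bessel process)] -/
def exRad (p : Fin 4 → ℝ) : ℝ := √(p 1 ^ 2 + p 2 ^ 2 + p 3 ^ 2)

/-- **The excursion point `x + i|w|`** of `p = (x, w) ∈ ℝ × ℝ³`. [cite: LawlerSchrammWerner2003Restriction, §4 p. 16 (B = X + iY)] -/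
def exPt (p : Fin 4 → ℝ) : ℂ := ⟨p 0, exRad p⟩

/-- **The domain `D_A = {|w| ≠ 0, x + i|w| ∉ A}`** on which the martingale function is harmonic.
[folklore] -/
def exDom (A : Set ℂ) : Set (Fin 4 → ℝ) := {p | exRad p ≠ 0 ∧ exPt p ∉ A}

/-- **The function `U = Im Φ_A(x + i|w|)/|w|`**: the conditional avoidance probability
"`P[Z ⊂ ℍ ∖ A] = Im[Φ(z)]/Im(z)`" of the proof of [LSW] Prop. 4.1, as a function of the
four-dimensional point `(x, w)` over `z = x + i|w|`. [cite: LawlerSchrammWerner2003Restriction, proof of Prop. 4.1 (p. 16)] -/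
def excursionRatio {A : Set ℂ} (Φ : ConformalEquiv (upperHalfPlaneSet \ A) upperHalfPlaneSet)
    (p : Fin 4 → ℝ) : ℝ :=
  (Φ (exPt p)).im / exRad p

/-- The sum of squares of the last three coordinates. [folklore] -/
def exSq (p : Fin 4 → ℝ) : ℝ := p 1 ^ 2 + p 2 ^ 2 + p 3 ^ 2

/-- `exSq ≥ 0`. [folklore] -/
theorem exSq_nonneg (p : Fin 4 → ℝ) : 0 ≤ exSq p := by unfold exSq; positivity

/-- `|w| = √(exSq)`. [folklore] -/
theorem exRad_eq_sqrt (p : Fin 4 → ℝ) : exRad p = √(exSq p) := rfl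

/-- `|w| ≥ 0`. [folklore] -/
theorem exRad_nonneg (p : Fin 4 → ℝ) : 0 ≤ exRad p := Real.sqrt_nonneg _

/-- `|w|² = w₁² + w₂² + w₃²`. [folklore] -/
theorem exRad_sq (p : Fin 4 → ℝ) : exRad p ^ 2 = exSq p := Real.sq_sqrt (exSq_nonneg p)

/-- `|w| ≠ 0 ↔ w₁² + w₂² + w₃² ≠ 0`. [folklore] -/
theorem exRad_ne_zero_iff {p : Fin 4 → ℝ} : exRad p ≠ 0 ↔ exSq p ≠ 0 := by
  rw [exRad_eq_sqrt, Ne, Real.sqrt_eq_zero (exSq_nonneg p)]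

/-- `|w| ≠ 0 → 0 < |w|`. [folklore] -/
theorem exRad_pos {p : Fin 4 → ℝ} (h : exRad p ≠ 0) : 0 < exRad p :=
  lt_of_le_of_ne (exRad_nonneg p) (Ne.symm h)

/-- `Re (x + i|w|) = x`. [folklore] -/
@[simp] theorem exPt_re (p : Fin 4 → ℝ) : (exPt p).re = p 0 := rfl

/-- `Im (x + i|w|) = |w|`. [folklore] -/
@[simp] theorem exPt_im (p : Fin 4 → ℝ) : (exPt p).im = exRad p := rfl

/-- `x + i|w|` as a sum. [folklore] -/
theorem exPt_eq (p : Fin 4 → ℝ) : exPt p = (p 0 : ℂ) + (exRad p : ℂ) * I :=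
  Complex.ext (by simp) (by simp)

/-- On `D_A` the excursion point lies in `ℍ ∖ A`. [folklore] -/
theorem exPt_mem_of_mem {A : Set ℂ} {p : Fin 4 → ℝ} (hp : p ∈ exDom A) :
    exPt p ∈ upperHalfPlaneSet \ A :=
  ⟨show 0 < (exPt p).im from exRad_pos hp.1, hp.2⟩

/-- The coordinate functions are smooth. [folklore] -/
theorem contDiff_apply_fin_four (i : Fin 4) : ContDiff ℝ ⊤ fun p : Fin 4 → ℝ ↦ p i :=
  contDiff_apply ℝ ℝ i

/-- `w₁² + w₂² + w₃²` is smooth. [folklore] -/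
theorem contDiff_exSq : ContDiff ℝ ⊤ exSq := by
  unfold exSq
  exact ((contDiff_apply_fin_four 1).pow 2).add ((contDiff_apply_fin_four 2).pow 2) |>.add
    ((contDiff_apply_fin_four 3).pow 2)

/-- `|w|` is continuous. [folklore] -/
theorem continuous_exRad : Continuous exRad :=
  Real.continuous_sqrt.comp contDiff_exSq.continuous

/-- `x + i|w|` is continuous. [folklore] -/
theorem continuous_exPt : Continuous exPt := by
  have : exPt = fun p ↦ (p 0 : ℂ) + (exRad p : ℂ) * I := funext exPt_eq
  rw [this]
  exact (continuous_ofReal.comp (continuous_apply 0)).add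
    ((continuous_ofReal.comp continuous_exRad).mul continuous_const)

/-- `D_A` is open for closed `A`. [folklore] -/
theorem isOpen_exDom {A : Set ℂ} (hA : IsClosed A) : IsOpen (exDom A) :=
  (isOpen_ne_fun continuous_exRad continuous_const).inter
    (hA.isOpen_compl.preimage continuous_exPt)

/-- `|w|` is smooth off `{w = 0}`. [folklore] -/
theorem contDiffOn_exRad : ContDiffOn ℝ ⊤ exRad {p | exRad p ≠ 0} := by
  rw [show exRad = fun p ↦ √(exSq p) from rfl]
  exact contDiff_exSq.contDiffOn.sqrt fun p hp ↦ exRad_ne_zero_iff.1 hp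

/-- The excursion point is a smooth function off `{w = 0}`. [folklore] -/
theorem contDiffOn_exPt : ContDiffOn ℝ ⊤ exPt {p | exRad p ≠ 0} := by
  have : exPt = fun p ↦ (p 0 : ℂ) + (exRad p : ℂ) * I := funext exPt_eq
  rw [this]
  refine ((ofRealCLM.contDiff.comp (contDiff_apply_fin_four 0)).contDiffOn).add ?_
  exact (ofRealCLM.contDiff.comp_contDiffOn contDiffOn_exRad).mul contDiffOn_const

variable {A : Set ℂ} {Φ : ConformalEquiv (upperHalfPlaneSet \ A) upperHalfPlaneSet}

/-- **`U` is smooth on `D_A`** (`Φ_A` is holomorphic on the open set `ℍ ∖ A`, `|w|` is smooth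
and nonzero). [folklore] -/
theorem contDiffOn_excursionRatio (hA : IsClosed A) : ContDiffOn ℝ ⊤ (excursionRatio Φ) (exDom A) := by
  have hO : IsOpen (upperHalfPlaneSet \ A) := isOpen_upperHalfPlaneSet_diff hA
  have hΦ : ContDiffOn ℝ ⊤ (Φ : ℂ → ℂ) (upperHalfPlaneSet \ A) :=
    (Φ.differentiableOn_coe.contDiffOn hO).restrict_scalars ℝ
  have hcomp : ContDiffOn ℝ ⊤ (fun p ↦ Φ (exPt p)) (exDom A) :=
    hΦ.comp (contDiffOn_exPt.mono fun p hp ↦ hp.1) fun p hp ↦ exPt_mem_of_mem hp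
  have him : ContDiffOn ℝ ⊤ (fun p ↦ (Φ (exPt p)).im) (exDom A) :=
    imCLM.contDiff.comp_contDiffOn hcomp
  exact him.div (contDiffOn_exRad.mono fun p hp ↦ hp.1) fun p hp ↦ hp.1

/-- `U` is `C²` on `D_A` (the regularity consumed by Dynkin's formula,
`Process.IsBrownianVec.integral_stoppedProcess_eq_of_harmonic`). [folklore] -/
theorem contDiffOn_excursionRatio_two (hA : IsClosed A) : ContDiffOn ℝ 2 (excursionRatio Φ) (exDom A) :=
  (contDiffOn_excursionRatio hA).of_le le_top

/-- **`0 < U` on `D_A`** (`Φ_A` maps into `ℍ`). [folklore] -/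
theorem excursionRatio_pos {p : Fin 4 → ℝ} (hp : p ∈ exDom A) : 0 < excursionRatio Φ p :=
  div_pos (Φ.mapsTo (exPt_mem_of_mem hp)) (exRad_pos hp.1)

/-- **`U ≤ 1` on `D_A`**: `Im Φ_A(z) ≤ Im z`. [cite: LawlerSchrammWerner2003Restriction, §2 p. 7 (Im g_A(z) ≤ Im z)] -/
theorem excursionRatio_le_one (hA : IsBounded A) (hΦ : IsRestrictionMap A Φ) {p : Fin 4 → ℝ}
    (hp : p ∈ exDom A) : excursionRatio Φ p ≤ 1 := by
  have h := hΦ.im_le_im hA (exPt_mem_of_mem hp)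
  rw [exPt_im] at h
  exact (div_le_one (exRad_pos hp.1)).2 h

end Coordinates

namespace ExcursionHarmonic

/-! ### One-variable calculus along the coordinate lines -/

section LineCalculus

/-- Derivative of the imaginary part of a path. [folklore] -/
theorem hasDerivAt_im_comp {F : ℝ → ℂ} {F' : ℂ} {t : ℝ} (h : HasDerivAt F F' t) :
    HasDerivAt (fun s ↦ (F s).im) F'.im t :=
  imCLM.hasFDerivAt.comp_hasDerivAt t h

/-- Derivative of the real part of a path. [folklore] -/
theorem hasDerivAt_re_comp {F : ℝ → ℂ} {F' : ℂ} {t : ℝ} (h : HasDerivAt F F' t) :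
    HasDerivAt (fun s ↦ (F s).re) F'.re t :=
  reCLM.hasFDerivAt.comp_hasDerivAt t h

/-- **The radius along a transverse coordinate line**: for `r > 0`,
`t ↦ √(r² + 2at + t²)` has derivative `(a + t)/√(r² + 2at + t²)` near `t = 0`. [folklore] -/
theorem eventually_hasDerivAt_sqrt_line {r : ℝ} (hr : 0 < r) (a : ℝ) :
    ∀ᶠ t in 𝓝 (0 : ℝ), 0 < r ^ 2 + 2 * a * t + t ^ 2 ∧
      HasDerivAt (fun s : ℝ ↦ √(r ^ 2 + 2 * a * s + s ^ 2))
        ((a + t) / √(r ^ 2 + 2 * a * t + t ^ 2)) t := by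
  have hq : ∀ t : ℝ, HasDerivAt (fun s : ℝ ↦ r ^ 2 + 2 * a * s + s ^ 2) (2 * a + 2 * t) t := by
    intro t
    have h1 : HasDerivAt (fun s : ℝ ↦ 2 * a * s) (2 * a) t :=
      ((hasDerivAt_id t).const_mul (2 * a)).congr_deriv (by simp)
    have h2 : HasDerivAt (fun s : ℝ ↦ s ^ 2) (2 * t) t :=
      (hasDerivAt_pow 2 t).congr_deriv (by simp)
    exact (h1.const_add (r ^ 2)).add h2
  have hcont : Continuous fun t : ℝ ↦ r ^ 2 + 2 * a * t + t ^ 2 := by fun_prop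
  have hpos : ∀ᶠ t in 𝓝 (0 : ℝ), 0 < r ^ 2 + 2 * a * t + t ^ 2 := by
    have h0 : (0 : ℝ) < r ^ 2 + 2 * a * 0 + 0 ^ 2 := by simpa using pow_pos hr 2
    exact (hcont.tendsto 0).eventually (lt_mem_nhds h0)
  filter_upwards [hpos] with t ht
  refine ⟨ht, ((hq t).sqrt ht.ne').congr_deriv ?_⟩
  have hs : 0 < √(r ^ 2 + 2 * a * t + t ^ 2) := Real.sqrt_pos.2 ht
  rw [show 2 * a + 2 * t = 2 * (a + t) by ring, mul_div_mul_left _ _ (two_ne_zero' ℝ)]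

/-- The value at `0`: `√(r²) = r`, derivative `a / r`. [folklore] -/
theorem hasDerivAt_sqrt_line_zero {r : ℝ} (hr : 0 < r) (a : ℝ) :
    HasDerivAt (fun s : ℝ ↦ √(r ^ 2 + 2 * a * s + s ^ 2)) (a / r) 0 := by
  have h := (eventually_hasDerivAt_sqrt_line hr a).self_of_nhds.2
  simp only [mul_zero, add_zero, ne_eq, OfNat.ofNat_ne_zero, not_false_eq_true, zero_pow,
    Real.sqrt_sq hr.le] at h
  exact h

/-- **Second derivative of the radius**: `t ↦ (a + t)/√(r² + 2at + t²)` has derivative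
`1/r − a²/r³` at `0`. [folklore] -/
theorem hasDerivAt_sqrt_line_deriv_zero {r : ℝ} (hr : 0 < r) (a : ℝ) :
    HasDerivAt (fun t : ℝ ↦ (a + t) / √(r ^ 2 + 2 * a * t + t ^ 2)) (1 / r - a ^ 2 / r ^ 3) 0 := by
  have hnum : HasDerivAt (fun t : ℝ ↦ a + t) 1 0 := by simpa using (hasDerivAt_id (0 : ℝ)).const_add a
  have hden := hasDerivAt_sqrt_line_zero hr a
  have hr0 : √(r ^ 2 + 2 * a * 0 + 0 ^ 2) = r := by simp [Real.sqrt_sq hr.le]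
  have h := hnum.div hden (by rw [hr0]; exact hr.ne')
  refine h.congr_deriv ?_
  rw [hr0]
  field_simp
  ring

variable {A : Set ℂ} {Φ : ConformalEquiv (upperHalfPlaneSet \ A) upperHalfPlaneSet}

/-- `Φ` has derivative `Φ'` at the points of the open set `ℍ ∖ A`. [folklore] -/
theorem hasDerivAt_coe (hA : IsClosed A) {w : ℂ} (hw : w ∈ upperHalfPlaneSet \ A) :
    HasDerivAt Φ (deriv Φ w) w :=
  (Φ.differentiableOn_coe.differentiableAt ((isOpen_upperHalfPlaneSet_diff hA).mem_nhds hw)).hasDerivAt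

/-- `Φ'` has derivative `Φ''` at the points of `ℍ ∖ A`. [folklore] -/
theorem hasDerivAt_deriv_coe (hA : IsClosed A) {w : ℂ} (hw : w ∈ upperHalfPlaneSet \ A) :
    HasDerivAt (deriv Φ) (deriv (deriv Φ) w) w :=
  ((Φ.differentiableOn_coe.deriv (isOpen_upperHalfPlaneSet_diff hA)).differentiableAt
    ((isOpen_upperHalfPlaneSet_diff hA).mem_nhds hw)).hasDerivAt

/-- **Horizontal line**: `s ↦ Im Φ(z + s)/r` has derivative `Im Φ'(z + t)/r` at `t` when
`z + t ∈ ℍ ∖ A`. [folklore] -/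
theorem hasDerivAt_horizontal (hA : IsClosed A) {z : ℂ} {t : ℝ} (r : ℝ)
    (ht : z + t ∈ upperHalfPlaneSet \ A) :
    HasDerivAt (fun s : ℝ ↦ (Φ (z + s)).im / r) ((deriv Φ (z + t)).im / r) t := by
  have h1 : HasDerivAt (fun s : ℝ ↦ Φ (z + s)) (deriv Φ (z + t)) t :=
    (HasDerivAt.comp_const_add z (t : ℂ) (hasDerivAt_coe hA ht)).comp_ofReal
  exact (hasDerivAt_im_comp h1).div_const r

/-- Second derivative along the horizontal line: `s ↦ Im Φ'(z + s)/r` has derivative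
`Im Φ''(z)/r` at `0`. [folklore] -/
theorem hasDerivAt_horizontal_deriv (hA : IsClosed A) {z : ℂ} (r : ℝ)
    (hz : z ∈ upperHalfPlaneSet \ A) :
    HasDerivAt (fun s : ℝ ↦ (deriv Φ (z + s)).im / r) ((deriv (deriv Φ) z).im / r) 0 := by
  have hz' : z + ((0 : ℝ) : ℂ) ∈ upperHalfPlaneSet \ A := by simpa using hz
  have h1 : HasDerivAt (fun s : ℝ ↦ deriv Φ (z + s)) (deriv (deriv Φ) (z + ((0 : ℝ) : ℂ))) 0 :=
    (HasDerivAt.comp_const_add z ((0 : ℝ) : ℂ) (hasDerivAt_deriv_coe hA hz')).comp_ofReal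
  have h2 := (hasDerivAt_im_comp h1).div_const r
  simpa using h2

/-- **Vertical line, the map**: `y ↦ Φ(x + iy)` has derivative `i Φ'(x + iy)`. [folklore] -/
theorem hasDerivAt_vertical_coe (hA : IsClosed A) {x : ℂ} {y : ℝ}
    (hy : x + y * I ∈ upperHalfPlaneSet \ A) :
    HasDerivAt (fun s : ℝ ↦ Φ (x + s * I)) (deriv Φ (x + y * I) * I) y := by
  have hin : HasDerivAt (fun w : ℂ ↦ x + w * I) I (y : ℂ) := by
    simpa using ((hasDerivAt_id (y : ℂ)).mul_const I).const_add x
  have h := (hasDerivAt_coe (Φ := Φ) hA hy).comp (y : ℂ) hin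
  exact (h.comp_ofReal).congr_deriv (by ring)

/-- Same for `Φ'`: `y ↦ Φ'(x + iy)` has derivative `i Φ''(x + iy)`. [folklore] -/
theorem hasDerivAt_vertical_deriv_coe (hA : IsClosed A) {x : ℂ} {y : ℝ}
    (hy : x + y * I ∈ upperHalfPlaneSet \ A) :
    HasDerivAt (fun s : ℝ ↦ deriv Φ (x + s * I)) (deriv (deriv Φ) (x + y * I) * I) y := by
  have hin : HasDerivAt (fun w : ℂ ↦ x + w * I) I (y : ℂ) := by
    simpa using ((hasDerivAt_id (y : ℂ)).mul_const I).const_add x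
  have h := (hasDerivAt_deriv_coe (Φ := Φ) hA hy).comp (y : ℂ) hin
  exact (h.comp_ofReal).congr_deriv (by ring)

/-- The first derivative of `G(y) = Im Φ(x + iy)/y` in closed form. [folklore] -/
def vertG₁ (Φ : ConformalEquiv (upperHalfPlaneSet \ A) upperHalfPlaneSet) (x : ℂ) (y : ℝ) : ℝ :=
  (deriv Φ (x + y * I)).re / y - (Φ (x + y * I)).im / y ^ 2

/-- **Vertical line, first derivative**: `G(y) = Im Φ(x + iy)/y` has derivative
`Re Φ'(x + iy)/y − Im Φ(x + iy)/y²` (`∂_y Im Φ = Re Φ'`). [folklore] -/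
theorem hasDerivAt_vertG (hA : IsClosed A) {x : ℂ} {y : ℝ}
    (hy : x + y * I ∈ upperHalfPlaneSet \ A) (hy0 : y ≠ 0) :
    HasDerivAt (fun s : ℝ ↦ (Φ (x + s * I)).im / s) (vertG₁ Φ x y) y := by
  have hnum := hasDerivAt_im_comp (hasDerivAt_vertical_coe (Φ := Φ) hA hy)
  have h := hnum.div (hasDerivAt_id y) hy0
  refine h.congr_deriv ?_
  simp only [mul_im, I_re, mul_zero, I_im, mul_one, id_eq, vertG₁]
  field_simp
  ring

/-- **Vertical line, second derivative**: the derivative of `vertG₁` at `y`,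
`−Im Φ''(x+iy)/y − 2 Re Φ'(x+iy)/y² + 2 Im Φ(x+iy)/y³`. [folklore] -/
theorem hasDerivAt_vertG₁ (hA : IsClosed A) {x : ℂ} {y : ℝ}
    (hy : x + y * I ∈ upperHalfPlaneSet \ A) (hy0 : y ≠ 0) :
    HasDerivAt (vertG₁ Φ x)
      (-(deriv (deriv Φ) (x + y * I)).im / y - 2 * (deriv Φ (x + y * I)).re / y ^ 2 +
        2 * (Φ (x + y * I)).im / y ^ 3) y := by
  -- first term `Re Φ'(x+iy)/y`
  have hre : HasDerivAt (fun s : ℝ ↦ (deriv Φ (x + s * I)).re)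
      (-(deriv (deriv Φ) (x + y * I)).im) y :=
    (hasDerivAt_re_comp (hasDerivAt_vertical_deriv_coe (Φ := Φ) hA hy)).congr_deriv (by simp)
  have h1 := hre.div (hasDerivAt_id y) hy0
  -- second term `Im Φ(x+iy)/y²`
  have him := hasDerivAt_im_comp (hasDerivAt_vertical_coe (Φ := Φ) hA hy)
  have hsq : HasDerivAt (fun s : ℝ ↦ s ^ 2) (2 * y) y := (hasDerivAt_pow 2 y).congr_deriv (by simp)
  have h2 := him.div hsq (pow_ne_zero 2 hy0)
  have h : HasDerivAt (vertG₁ Φ x) _ y :=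
    (h1.sub h2).congr_of_eventuallyEq (Eventually.of_forall fun s ↦ by
      simp only [vertG₁, Pi.sub_apply, Pi.div_apply, id_eq])
  refine h.congr_deriv ?_
  simp only [mul_im, I_re, mul_zero, I_im, mul_one, id_eq]
  field_simp
  ring

end LineCalculus

/-! ### The excursion function along the four coordinate lines; the Hessian -/

section Lines

variable {A : Set ℂ} {Φ : ConformalEquiv (upperHalfPlaneSet \ A) upperHalfPlaneSet}

/-- Coordinates of the basis vectors. [folklore] -/
theorem bvec_apply_fin (i j : Fin 4) : (bvec i : Fin 4 → ℝ) j = if j = i then 1 else 0 := by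
  simp [bvec, Pi.single_apply]

/-- Coordinates of `p + t eᵢ`. [folklore] -/
theorem add_smul_bvec_apply (p : Fin 4 → ℝ) (t : ℝ) (i j : Fin 4) :
    (p + t • bvec i) j = p j + if j = i then t else 0 := by
  simp [bvec_apply_fin, mul_ite]

/-- Along `e₀` the radius is constant. [folklore] -/
theorem exSq_add_smul_bvec_zero (p : Fin 4 → ℝ) (t : ℝ) : exSq (p + t • bvec 0) = exSq p := by
  simp [exSq, bvec_apply_fin]

/-- Along `e₀`, `|w|` is constant. [folklore] -/
theorem exRad_add_smul_bvec_zero (p : Fin 4 → ℝ) (t : ℝ) : exRad (p + t • bvec 0) = exRad p := by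
  rw [exRad_eq_sqrt, exRad_eq_sqrt, exSq_add_smul_bvec_zero]

/-- Along `e₀` the excursion point moves horizontally. [folklore] -/
theorem exPt_add_smul_bvec_zero (p : Fin 4 → ℝ) (t : ℝ) : exPt (p + t • bvec 0) = exPt p + t :=
  Complex.ext (by simp [bvec_apply_fin]) (by simp [exRad_add_smul_bvec_zero])

/-- Along `eᵢ`, `i ≠ 0`, the squared radius is `r² + 2pᵢt + t²`. [folklore] -/
theorem exSq_add_smul_bvec (p : Fin 4 → ℝ) (t : ℝ) {i : Fin 4} (hi : i ≠ 0) :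
    exSq (p + t • bvec i) = exRad p ^ 2 + 2 * p i * t + t ^ 2 := by
  rw [exRad_sq]
  fin_cases i
  · exact absurd rfl hi
  all_goals simp [exSq, bvec_apply_fin]; ring

/-- Along `eᵢ`, `i ≠ 0`, `|w + t eᵢ| = √(r² + 2pᵢt + t²)`. [folklore] -/
theorem exRad_add_smul_bvec (p : Fin 4 → ℝ) (t : ℝ) {i : Fin 4} (hi : i ≠ 0) :
    exRad (p + t • bvec i) = √(exRad p ^ 2 + 2 * p i * t + t ^ 2) := by
  rw [exRad_eq_sqrt, exSq_add_smul_bvec p t hi]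

/-- Along `eᵢ`, `i ≠ 0`, the excursion point moves vertically to height `√(r² + 2pᵢt + t²)`.
[folklore] -/
theorem exPt_add_smul_bvec (p : Fin 4 → ℝ) (t : ℝ) {i : Fin 4} (hi : i ≠ 0) :
    exPt (p + t • bvec i) = ((p 0 : ℝ) : ℂ) + (√(exRad p ^ 2 + 2 * p i * t + t ^ 2) : ℝ) * I := by
  rw [exPt_eq, exRad_add_smul_bvec p t hi, add_smul_bvec_apply, if_neg hi.symm, add_zero]

/-- `U` along `e₀`. [folklore] -/
theorem excursionRatio_add_smul_bvec_zero (p : Fin 4 → ℝ) (t : ℝ) :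
    excursionRatio Φ (p + t • bvec 0) = (Φ (exPt p + t)).im / exRad p := by
  rw [excursionRatio, exPt_add_smul_bvec_zero, exRad_add_smul_bvec_zero]

/-- `U` along `eᵢ`, `i ≠ 0`: `G(ρ(t))` with `G(y) = Im Φ(x + iy)/y`, `ρ(t) = √(r² + 2pᵢt + t²)`.
[folklore] -/
theorem excursionRatio_add_smul_bvec (p : Fin 4 → ℝ) (t : ℝ) {i : Fin 4} (hi : i ≠ 0) :
    excursionRatio Φ (p + t • bvec i) =
      ((fun y : ℝ ↦ (Φ (((p 0 : ℝ) : ℂ) + y * I)).im / y) ∘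
        fun s : ℝ ↦ √(exRad p ^ 2 + 2 * p i * s + s ^ 2)) t := by
  simp only [Function.comp_apply, excursionRatio, exPt_add_smul_bvec p t hi, exRad_add_smul_bvec p t hi]

/-- `U` is `C²` at the points of `D_A`. [folklore] -/
theorem contDiffAt_excursionRatio (hA : IsClosed A) {p : Fin 4 → ℝ} (hp : p ∈ exDom A) :
    ContDiffAt ℝ 2 (excursionRatio Φ) p :=
  ((contDiffOn_excursionRatio hA).contDiffAt ((isOpen_exDom hA).mem_nhds hp)).of_le le_top

/-- **`D²U(p)(e₀, e₀) = Im Φ''(z)/r`** (`z = x + ir` the excursion point of `p`). [folklore] -/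
theorem hess_excursionRatio_zero (hA : IsClosed A) {p : Fin 4 → ℝ} (hp : p ∈ exDom A) :
    hess (excursionRatio Φ) p (bvec 0) (bvec 0) = (deriv (deriv Φ) (exPt p)).im / exRad p := by
  have hz : exPt p ∈ upperHalfPlaneSet \ A := exPt_mem_of_mem hp
  have hO : IsOpen (upperHalfPlaneSet \ A) := isOpen_upperHalfPlaneSet_diff hA
  have hev : ∀ᶠ t : ℝ in 𝓝 0, exPt p + (t : ℂ) ∈ upperHalfPlaneSet \ A := by
    have hc : Continuous fun t : ℝ ↦ exPt p + (t : ℂ) := by fun_prop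
    have h := hc.tendsto 0
    simp only [ofReal_zero, add_zero] at h
    exact h.eventually (hO.mem_nhds hz)
  refine hess_apply_eq_of_hasDerivAt (contDiffAt_excursionRatio hA hp)
    (g₁ := fun t : ℝ ↦ (deriv Φ (exPt p + (t : ℂ))).im / exRad p) ?_ (hasDerivAt_horizontal_deriv hA _ hz)
  filter_upwards [hev] with t ht
  have hfun : (fun s : ℝ ↦ excursionRatio Φ (p + s • bvec 0)) =
      fun s : ℝ ↦ (Φ (exPt p + (s : ℂ))).im / exRad p :=
    funext fun s ↦ excursionRatio_add_smul_bvec_zero p s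
  rw [hfun]
  exact hasDerivAt_horizontal hA _ ht

/-- The coefficient `G''(r)` of the transverse Hessian entries. [folklore] -/
def vertG₂ (Φ : ConformalEquiv (upperHalfPlaneSet \ A) upperHalfPlaneSet) (x : ℂ) (y : ℝ) : ℝ :=
  -(deriv (deriv Φ) (x + y * I)).im / y - 2 * (deriv Φ (x + y * I)).re / y ^ 2 +
    2 * (Φ (x + y * I)).im / y ^ 3

/-- **`D²U(p)(eᵢ, eᵢ) = G''(r) (pᵢ/r)² + G'(r) (1/r − pᵢ²/r³)`** for `i ≠ 0`, with
`G(y) = Im Φ(x + iy)/y` (chain rule through the radius `|w + t eᵢ|`). [folklore] -/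
theorem hess_excursionRatio_of_ne (hA : IsClosed A) {p : Fin 4 → ℝ} (hp : p ∈ exDom A)
    {i : Fin 4} (hi : i ≠ 0) :
    hess (excursionRatio Φ) p (bvec i) (bvec i) =
      vertG₂ Φ (p 0) (exRad p) * (p i / exRad p) ^ 2 +
        vertG₁ Φ (p 0) (exRad p) * (1 / exRad p - p i ^ 2 / exRad p ^ 3) := by
  set r := exRad p with hr_def
  set x : ℂ := ((p 0 : ℝ) : ℂ) with hx_def
  have hr : 0 < r := exRad_pos hp.1
  have hO : IsOpen (upperHalfPlaneSet \ A) := isOpen_upperHalfPlaneSet_diff hA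
  have hzeq : exPt p = x + (r : ℂ) * I := exPt_eq p
  have hz : x + (r : ℂ) * I ∈ upperHalfPlaneSet \ A := hzeq ▸ exPt_mem_of_mem hp
  -- the radius `ρ` along the line and its derivative
  set ρ : ℝ → ℝ := fun s ↦ √(r ^ 2 + 2 * p i * s + s ^ 2) with hρ_def
  have hρ0 : ρ 0 = r := by simp [hρ_def, Real.sqrt_sq hr.le]
  have hρc : Continuous ρ := by
    simp only [hρ_def]
    fun_prop
  have hmem : ∀ᶠ t : ℝ in 𝓝 0, x + (ρ t : ℂ) * I ∈ upperHalfPlaneSet \ A := by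
    have hc : Continuous fun t : ℝ ↦ x + (ρ t : ℂ) * I := by fun_prop
    have h := hc.tendsto 0
    rw [hρ0] at h
    exact h.eventually (hO.mem_nhds hz)
  -- first derivative along the line
  have h₁ : ∀ᶠ t : ℝ in 𝓝 0, HasDerivAt (fun s : ℝ ↦ excursionRatio Φ (p + s • bvec i))
      (vertG₁ Φ x (ρ t) * ((p i + t) / ρ t)) t := by
    filter_upwards [eventually_hasDerivAt_sqrt_line hr (p i), hmem] with t ⟨hq, hρ'⟩ ht
    have hρt : ρ t ≠ 0 := (Real.sqrt_pos.2 hq).ne'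
    have hG := hasDerivAt_vertG (Φ := Φ) hA ht hρt
    have hfun : (fun s : ℝ ↦ excursionRatio Φ (p + s • bvec i)) =
        (fun y : ℝ ↦ (Φ (x + y * I)).im / y) ∘ ρ := funext fun s ↦ excursionRatio_add_smul_bvec p s hi
    rw [hfun]
    exact hG.comp t hρ'
  -- second derivative at `0`
  have hc : HasDerivAt (fun t : ℝ ↦ vertG₁ Φ x (ρ t)) (vertG₂ Φ x r * (p i / r)) 0 := by
    have hG₁ := hasDerivAt_vertG₁ (Φ := Φ) hA hz hr.ne'
    exact hG₁.comp_of_eq (0 : ℝ) (hasDerivAt_sqrt_line_zero hr (p i)) hρ0.symm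
  have hd := hasDerivAt_sqrt_line_deriv_zero hr (p i)
  have h₂ := hc.mul hd
  have h₂' : HasDerivAt (fun t : ℝ ↦ vertG₁ Φ x (ρ t) * ((p i + t) / ρ t))
      (vertG₂ Φ x r * (p i / r) ^ 2 + vertG₁ Φ x r * (1 / r - p i ^ 2 / r ^ 3)) 0 := by
    have hs0 : √(r ^ 2 + 2 * p i * 0 + 0 ^ 2) = r := by simp [Real.sqrt_sq hr.le]
    refine h₂.congr_deriv ?_
    rw [hs0, hρ0]
    field_simp
    ring
  exact hess_apply_eq_of_hasDerivAt (contDiffAt_excursionRatio hA hp) h₁ h₂'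

end Lines

end ExcursionHarmonic

/-! ### Harmonicity -/

section Harmonic

variable {A : Set ℂ} {Φ : ConformalEquiv (upperHalfPlaneSet \ A) upperHalfPlaneSet}

open ExcursionHarmonic in
/-- **`U = Im Φ_A(x + i|w|)/|w|` is harmonic on `D_A`** (`Δ_{ℝ⁴} U = 0` for the Laplacian of
`Process/GaussianTaylorStep`): the planar harmonic function `Im Φ_A`, divided by the height and
rotated about the real axis into `ℝ × ℝ³`, is harmonic — the `h`-transform identity which, with
Dynkin's formula, gives "`P[Z ⊂ ℍ ∖ A] = Im[Φ(z)]/Im(z)`" in the proof of [LSW] Prop. 4.1.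
[cite: LawlerSchrammWerner2003Restriction, proof of Prop. 4.1 (p. 16); RevuzYor1999, Ch. VI §3] -/
theorem lap_excursionRatio_eq_zero (hA : IsClosed A) {p : Fin 4 → ℝ} (hp : p ∈ exDom A) :
    lap (excursionRatio Φ) p = 0 := by
  have hr : 0 < exRad p := exRad_pos hp.1
  set r := exRad p with hr_def
  have hsq : r ^ 2 = p 1 ^ 2 + p 2 ^ 2 + p 3 ^ 2 := exRad_sq p
  have h1 : (1 : Fin 4) ≠ 0 := by decide
  have h2 : (2 : Fin 4) ≠ 0 := by decide
  have h3 : (3 : Fin 4) ≠ 0 := by decide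
  rw [lap, Fin.sum_univ_four, hess_excursionRatio_zero hA hp, hess_excursionRatio_of_ne hA hp h1,
    hess_excursionRatio_of_ne hA hp h2, hess_excursionRatio_of_ne hA hp h3]
  have hS1 : (p 1 / r) ^ 2 + (p 2 / r) ^ 2 + (p 3 / r) ^ 2 = 1 := by
    field_simp
    linarith [hsq]
  have hS2 : (1 / r - p 1 ^ 2 / r ^ 3) + (1 / r - p 2 ^ 2 / r ^ 3) + (1 / r - p 3 ^ 2 / r ^ 3) = 2 / r := by
    field_simp
    nlinarith [hsq]
  set G₂ := vertG₂ Φ (p 0) r with hG₂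
  set G₁ := vertG₁ Φ (p 0) r with hG₁
  have hzeq : ((p 0 : ℝ) : ℂ) + (r : ℂ) * I = exPt p := (exPt_eq p).symm
  calc (deriv (deriv Φ) (exPt p)).im / r + (G₂ * (p 1 / r) ^ 2 + G₁ * (1 / r - p 1 ^ 2 / r ^ 3)) +
        (G₂ * (p 2 / r) ^ 2 + G₁ * (1 / r - p 2 ^ 2 / r ^ 3)) +
        (G₂ * (p 3 / r) ^ 2 + G₁ * (1 / r - p 3 ^ 2 / r ^ 3))
      = (deriv (deriv Φ) (exPt p)).im / r + G₂ * ((p 1 / r) ^ 2 + (p 2 / r) ^ 2 + (p 3 / r) ^ 2) +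
          G₁ * ((1 / r - p 1 ^ 2 / r ^ 3) + (1 / r - p 2 ^ 2 / r ^ 3) + (1 / r - p 3 ^ 2 / r ^ 3)) := by
        ring
    _ = (deriv (deriv Φ) (exPt p)).im / r + G₂ * 1 + G₁ * (2 / r) := by rw [hS1, hS2]
    _ = 0 := by
        rw [hG₂, hG₁, vertG₂, vertG₁, hzeq]
        field_simp
        ring

end Harmonic

/-! ### Boundary values: at `0`, at `∞`, and on `A` -/

section Boundary

variable {A : Set ℂ} {Φ : ConformalEquiv (upperHalfPlaneSet \ A) upperHalfPlaneSet}

/-- **`Im Φ_A(z)/Im z → Φ'_A(0)` as `z → 0` inside `ℍ ∖ A`** (the last display of the proof of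
[LSW] Prop. 4.1: "When `z → 0`, `Φ(z) = zΦ'(0) + O(|z|²)` so that
`… = lim_{s→0} E[Im(Φ(B_s))/Im(B_s)] = Φ'(0)`", here uniformly in the direction of approach):
the Schwarz reflection `E = hullExt Φ` is holomorphic near `0` with `E'(0) = Φ'_A(0)`, hence
strictly differentiable there, and `Im Φ(z)/Im z = (E(z) − E(z̄))/(z − z̄)`.
[cite: LawlerSchrammWerner2003Restriction, proof of Prop. 4.1 (p. 16) with p. 12 (Schwarz reflection)] -/
theorem IsRestrictionMap.tendsto_im_div_im_nhdsWithin_zero (hA : IsStarHull A)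
    (hΦ : IsRestrictionMap A Φ) {d : ℝ} (hd : HasRestrictionDeriv A Φ d) :
    Tendsto (fun z ↦ (Φ z).im / z.im) (𝓝[upperHalfPlaneSet \ A] 0) (𝓝 d) := by
  have hO : IsOpen (symmDomain A) := isOpen_symmDomain hA.1.isClosed
  have h0 : (0 : ℂ) ∈ symmDomain A := hA.zero_mem_symmDomain
  have hcd : ContDiffAt ℂ ⊤ (hullExt Φ) 0 :=
    ((differentiableOn_hullExt hA.1 hΦ).contDiffOn hO).contDiffAt (hO.mem_nhds h0)
  have hstrict : HasStrictDerivAt (hullExt Φ) (d : ℂ) 0 := by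
    have h := hcd.hasStrictDerivAt (by simp)
    rwa [deriv_hullExt_zero hA hΦ hd] at h
  have ho := hasDerivAtFilter_iff_isLittleO.1 hstrict
  have hk : Tendsto (fun z : ℂ ↦ (z, conj z)) (𝓝[upperHalfPlaneSet \ A] 0) (𝓝 (0, 0)) := by
    have hc : Continuous fun z : ℂ ↦ (z, conj z) := continuous_id.prodMk continuous_conj
    have h := hc.tendsto 0
    simp only [map_zero] at h
    exact h.mono_left nhdsWithin_le_nhds
  have ho' := ho.comp_tendsto hk
  rw [Metric.tendsto_nhds]
  intro ε hε
  filter_upwards [ho'.def (half_pos hε), self_mem_nhdsWithin] with z hz hzO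
  have hzim : 0 < z.im := hzO.1
  have hE1 : hullExt Φ z = Φ z := hullExt_of_mem_diff hzO
  have hE2 : hullExt Φ (conj z) = conj (Φ z) := by
    rw [hullExt_conj hA.1 hΦ (hA.1.mem_symmDomain_of_mem_diff hzO), hE1]
  have hf : hullExt Φ z - hullExt Φ (conj z) - (z - conj z) • (d : ℂ) =
      ((2 * ((Φ z).im - d * z.im) : ℝ) : ℂ) * I := by
    rw [hE1, hE2, Complex.sub_conj, Complex.sub_conj, smul_eq_mul]
    push_cast
    ring
  have hnf : ‖hullExt Φ z - hullExt Φ (conj z) - (z - conj z) • (d : ℂ)‖ =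
      2 * |(Φ z).im - d * z.im| := by
    rw [hf, norm_mul, norm_I, mul_one, norm_real, Real.norm_eq_abs, abs_mul, abs_two]
  have hng : ‖z - conj z‖ = 2 * z.im := by
    rw [Complex.sub_conj, norm_mul, norm_I, mul_one, norm_real, Real.norm_eq_abs, abs_mul, abs_two,
      abs_of_pos hzim]
  have hz' : 2 * |(Φ z).im - d * z.im| ≤ ε / 2 * (2 * z.im) := by
    have := hz
    simp only [Function.comp_apply] at this
    rwa [hnf, hng] at this
  rw [Real.dist_eq, show (Φ z).im / z.im - d = ((Φ z).im - d * z.im) / z.im by field_simp,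
    abs_div, abs_of_pos hzim, div_lt_iff₀ hzim]
  nlinarith

/-- **On `ℝ⁴`: `U(p) → Φ'_A(0)` as `p → 0` inside `D_A`.** [cite: LawlerSchrammWerner2003Restriction, proof of Prop. 4.1 (p. 16, last display)] -/
theorem tendsto_excursionRatio_nhdsWithin_zero (hA : IsStarHull A) (hΦ : IsRestrictionMap A Φ)
    {d : ℝ} (hd : HasRestrictionDeriv A Φ d) :
    Tendsto (excursionRatio Φ) (𝓝[exDom A] 0) (𝓝 d) := by
  have h0 : exPt 0 = 0 := Complex.ext (by simp) (by simp [exRad])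
  have hk : Tendsto exPt (𝓝[exDom A] 0) (𝓝[upperHalfPlaneSet \ A] 0) := by
    have h := (continuous_exPt.continuousWithinAt (s := exDom A) (x := 0)).tendsto_nhdsWithin
      (fun p hp ↦ exPt_mem_of_mem hp)
    rwa [h0] at h
  exact (hΦ.tendsto_im_div_im_nhdsWithin_zero hA hd).comp hk

/-- **`Im z − Im Φ_A(z)` is bounded on `ℍ ∖ A`**: far out `|E(z) − z − L| < 1` with `L` real
(`tendsto_hullExt_sub_self`, `hullShift_im`), and on bounded sets `Im z − Im Φ(z) ≤ Im z`.
[cite: LawlerSchrammWerner2003Restriction, §2 pp. 7–8 (g_A(z) − z → 0, Φ_A = g_A − g_A(0))] -/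
theorem IsRestrictionMap.exists_forall_im_sub_im_le (hA : IsStarHull A) (hΦ : IsRestrictionMap A Φ) :
    ∃ C : ℝ, ∀ z ∈ upperHalfPlaneSet \ A, z.im - (Φ z).im ≤ C := by
  have hT := tendsto_hullExt_sub_self hA.1 hΦ
  have hev : ∀ᶠ z in cocompact ℂ, ‖hullExt Φ z - z - hullShift Φ‖ < 1 := by
    filter_upwards [hT (ball_mem_nhds _ one_pos)] with z hz
    simpa [dist_eq_norm] using hz
  rw [← cobounded_eq_cocompact, (hasBasis_cobounded_compl_closedBall (0 : ℂ)).eventually_iff] at hev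
  obtain ⟨R, -, hR⟩ := hev
  refine ⟨max R 1, fun z hz ↦ ?_⟩
  by_cases hzR : z ∈ closedBall (0 : ℂ) R
  · have h1 : (0 : ℝ) < (Φ z).im := Φ.mapsTo hz
    have h2 : z.im ≤ ‖z‖ := Complex.im_le_norm z
    have h3 : ‖z‖ ≤ R := mem_closedBall_zero_iff.1 hzR
    linarith [le_max_left R 1]
  · have h := hR hzR
    have hE : hullExt Φ z = Φ z := hullExt_of_mem_diff hz
    have hLim : (hullShift Φ).im = 0 := hullShift_im hA.1 hΦ
    have him := Complex.abs_im_le_norm (hullExt Φ z - z - hullShift Φ)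
    rw [hE] at him h
    simp only [sub_im, hLim, sub_zero] at him
    have := (abs_le.1 (him.trans h.le)).1
    linarith [le_max_right R 1]

/-- **On `ℝ⁴`: `1 − C/|w| ≤ U(p)` on `D_A`**, so that `U → 1` along any path with `|w| → ∞`
(on the event that the excursion avoids `A`, given "almost surely `lim_{t→∞} Y_t = ∞`").
[cite: LawlerSchrammWerner2003Restriction, §4 p. 16 and proof of Prop. 4.1] -/
theorem one_sub_div_le_excursionRatio (hA : IsStarHull A) (hΦ : IsRestrictionMap A Φ) :
    ∃ C : ℝ, ∀ p ∈ exDom A, 1 - C / exRad p ≤ excursionRatio Φ p := by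
  obtain ⟨C, hC⟩ := hΦ.exists_forall_im_sub_im_le hA
  refine ⟨C, fun p hp ↦ ?_⟩
  have hr : 0 < exRad p := exRad_pos hp.1
  have h := hC _ (exPt_mem_of_mem hp)
  rw [exPt_im] at h
  rw [excursionRatio, le_div_iff₀ hr]
  have heq : (1 - C / exRad p) * exRad p = exRad p - C := by field_simp
  rw [heq]
  linarith

/-- **`Im Φ_A(z) → 0` as `z → a ∈ A` inside `ℍ ∖ A`** (on the event that the excursion hits `A`,
the stopped value of `U` is `0` in the limit): if `Im Φ(zₙ) ≥ ε` along `zₙ → a`, the bounded sequence `Φ(zₙ)` (`isBounded_image`) accumulates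
at a point `q` of the OPEN half-plane, and `zₙ = Φ⁻¹(Φ(zₙ)) → Φ⁻¹(q) ∈ ℍ ∖ A` by continuity of
`Φ⁻¹` on `ℍ`, contradicting `a ∈ A`. (Compactness form: `Φ⁻¹(cl Φ(U) ∩ {Im ≥ ε})` is a compact
subset of `ℍ ∖ A`, hence at positive distance from `a`.) [folklore] -/
theorem IsRestrictionMap.tendsto_im_nhdsWithin_of_mem (hA : IsStarHull A) (hΦ : IsRestrictionMap A Φ)
    {a : ℂ} (haA : a ∈ A) :
    Tendsto (fun z ↦ (Φ z).im) (𝓝[upperHalfPlaneSet \ A] a) (𝓝 0) := by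
  rw [tendsto_order]
  refine ⟨fun b hb ↦ eventually_nhdsWithin_of_forall fun z hz ↦ hb.trans (Φ.mapsTo hz), fun ε hε ↦ ?_⟩
  -- the compact set `K = cl Φ(O ∩ B̄(a,1)) ∩ {Im ≥ ε} ⊆ ℍ` and its compact preimage in `O`
  set S := Φ '' ((upperHalfPlaneSet \ A) ∩ closedBall a 1) with hS_def
  have hSb : IsBounded S :=
    hΦ.isBounded_image hA inter_subset_left (isBounded_closedBall.subset inter_subset_right)
  set K := closure S ∩ {q : ℂ | ε ≤ q.im} with hK_def
  have hKc : IsCompact K := hSb.isCompact_closure.inter_right (isClosed_le continuous_const continuous_im)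
  have hKH : K ⊆ upperHalfPlaneSet := fun q hq ↦ show 0 < q.im from hε.trans_le hq.2
  have hK'c : IsCompact (Φ.symm '' K) := hKc.image_of_continuousOn (Φ.symm.continuousOn.mono hKH)
  have hK'O : Φ.symm '' K ⊆ upperHalfPlaneSet \ A := by
    rintro _ ⟨q, hq, rfl⟩
    exact Φ.symm_mapsTo (hKH hq)
  have haK' : a ∉ Φ.symm '' K := fun h ↦ (hK'O h).2 haA
  obtain ⟨δ, hδ, hδK⟩ := Metric.mem_nhds_iff.1 (hK'c.isClosed.isOpen_compl.mem_nhds haK')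
  -- near `a`, inside `O`, `Im Φ < ε`
  filter_upwards [inter_mem_nhdsWithin (upperHalfPlaneSet \ A) (ball_mem_nhds a (lt_min hδ one_pos))]
    with z ⟨hzO, hz⟩
  by_contra hge
  rw [not_lt] at hge
  have hzK : Φ z ∈ K := by
    refine ⟨subset_closure ⟨z, ⟨hzO, ?_⟩, rfl⟩, hge⟩
    exact mem_closedBall.2 ((mem_ball.1 hz).trans_le (min_le_right _ _)).le
  have hzK' : z ∈ Φ.symm '' K := ⟨Φ z, hzK, Φ.symm_apply_apply hzO⟩
  exact hδK ((ball_subset_ball (min_le_left _ _)) hz) hzK'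

/-- **On `ℝ⁴`: `U(p) → 0` as `p → q` inside `D_A`, for `q` with `|w| ≠ 0` and excursion point in
`A`** (the hitting of `A` by the excursion). [cite: LawlerSchrammWerner2003Restriction, proof of Prop. 4.1 (p. 16)] -/
theorem tendsto_excursionRatio_of_mem (hA : IsStarHull A) (hΦ : IsRestrictionMap A Φ)
    {q : Fin 4 → ℝ} (hq : exRad q ≠ 0) (hqA : exPt q ∈ A) :
    Tendsto (excursionRatio Φ) (𝓝[exDom A] q) (𝓝 0) := by
  have hk : Tendsto exPt (𝓝[exDom A] q) (𝓝[upperHalfPlaneSet \ A] (exPt q)) :=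
    (continuous_exPt.continuousWithinAt (s := exDom A) (x := q)).tendsto_nhdsWithin
      fun p hp ↦ exPt_mem_of_mem hp
  have hnum : Tendsto (fun p ↦ (Φ (exPt p)).im) (𝓝[exDom A] q) (𝓝 0) :=
    (hΦ.tendsto_im_nhdsWithin_of_mem hA hqA).comp hk
  have hden : Tendsto exRad (𝓝[exDom A] q) (𝓝 (exRad q)) :=
    (continuous_exRad.tendsto q).mono_left nhdsWithin_le_nhds
  have h := hnum.div hden hq
  rw [zero_div] at h
  exact h

/-- `U` is continuous on `D_A`. [folklore] -/
theorem continuousOn_excursionRatio (hA : IsClosed A) : ContinuousOn (excursionRatio Φ) (exDom A) :=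
  (contDiffOn_excursionRatio hA).continuousOn

open MeasureTheory in
/-- **A measurable version**: `U` on `D_A`, `0` elsewhere, is Borel measurable on `ℝ⁴` (for the
random variables `U(W_t)`). [folklore] -/
theorem measurable_indicator_excursionRatio (hA : IsClosed A) :
    Measurable ((exDom A).indicator (excursionRatio Φ)) := by
  classical
  have h : (exDom A).indicator (excursionRatio Φ) = (exDom A).piecewise (excursionRatio Φ) 0 := by
    ext p
    by_cases hp : p ∈ exDom A <;> simp [hp]
  rw [h]
  exact (continuousOn_excursionRatio hA).measurable_piecewise continuousOn_const (isOpen_exDom hA).measurableSet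

/-! ### Summary: the martingale function of [LSW] Prop. 4.1 -/

/-- **The analytic half of [LSW] Prop. 4.1, bundled.** For `A ∈ 𝒬*` with restriction map `Φ`
and `d = Φ'_A(0)`, the function `U = Im Φ(x + i|w|)/|w|` on `D_A ⊆ ℝ⁴` is smooth and harmonic,
takes values in `(0, 1]`, tends to `d` at the origin and to `0` at the points over `A ∩ ℍ`,
and satisfies `1 − C/|w| ≤ U`. [cite: LawlerSchrammWerner2003Restriction, Prop. 4.1 (p. 16) and its proof] -/
theorem excursionRatio_spec (hA : IsStarHull A) (hΦ : IsRestrictionMap A Φ) {d : ℝ}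
    (hd : HasRestrictionDeriv A Φ d) :
    ContDiffOn ℝ ⊤ (excursionRatio Φ) (exDom A) ∧
      (∀ p ∈ exDom A, lap (excursionRatio Φ) p = 0) ∧
      (∀ p ∈ exDom A, 0 < excursionRatio Φ p ∧ excursionRatio Φ p ≤ 1) ∧
      Tendsto (excursionRatio Φ) (𝓝[exDom A] 0) (𝓝 d) ∧
      (∀ q : Fin 4 → ℝ, exRad q ≠ 0 → exPt q ∈ A → Tendsto (excursionRatio Φ) (𝓝[exDom A] q) (𝓝 0)) ∧
      ∃ C : ℝ, ∀ p ∈ exDom A, 1 - C / exRad p ≤ excursionRatio Φ p :=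
  ⟨contDiffOn_excursionRatio hA.1.isClosed, fun _ hp ↦ lap_excursionRatio_eq_zero hA.1.isClosed hp,
    fun _ hp ↦ ⟨excursionRatio_pos hp, excursionRatio_le_one hA.1.1 hΦ hp⟩,
    tendsto_excursionRatio_nhdsWithin_zero hA hΦ hd,
    fun _ hq hqA ↦ tendsto_excursionRatio_of_mem hA hΦ hq hqA, one_sub_div_le_excursionRatio hA hΦ⟩

end Boundary

end Literature.Probability.RandomPlanarGeometry

end
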